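import Mathlib.Analysis.InnerProductSpace.PiL2
import Mathlib.Analysis.Calculus.FDeriv.Basic
import Mathlib.Analysis.Calculus.ContDiff.Defs
import Mathlib.Analysis.SpecialFunctions.Pow.Real
import Mathlib.MeasureTheory.Integral.Bochner.Basic
import Mathlib.MeasureTheory.Integral.Lebesgue.Basic
import Mathlib.MeasureTheory.Measure.Haar.InnerProductSpace
import Mathlib.MeasureTheory.Constructions.Pi
import Mathlib.Order.Filter.AtTopBot.Basic
import Mathlib.Analysis.Calculus.BumpFunction.FiniteDimension
import Mathlib.Analysis.Calculus.BumpFunction.Normed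
import Mathlib.MeasureTheory.Function.L1Space.Integrable
import Mathlib.MeasureTheory.Integral.Bochner.ContinuousLinearMap
import HarnessLib

/-!
# Bose–Einstein condensation in the ground state of the interacting Bose gas

Topic `Literature/MathematicalPhysics/QuantumManyBody` (definition item
`defn-BoseEinsteinCondensation`; conjunct `BoseEinsteinCondensation` of the tier-2 summit
`AtomisticToContinuum`, D-0013).

We formalise, over real definitions and without operators or Sobolev spaces, the
Penrose–Onsager / Lieb–Seiringer–Solovej–Yngvason notion of Bose–Einstein condensation (BEC)
in the **ground state** of `N` bosons in a box `Λ_L = (0,L)³ ⊂ ℝ³` with a repulsive radial pair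
interaction, `H_N = -∑ᵢ Δᵢ + ∑_{i<j} v(|xᵢ - xⱼ|)` (units `ħ = 2m = 1`), in the thermodynamic
limit `N → ∞`, `L → ∞`, `N / L³ = ρ` fixed [LSSY 2005, §1.2, eqs. (1.16)–(1.19); Ch. 5,
(5.1)–(5.2)].

* `Space = EuclideanSpace ℝ (Fin 3)`, `Config N = Fin N → Space`, `box L`, `boxN N L = Λ_L^N`.
* `TrialState N L` — admissible (Dirichlet) trial wave functions: `ψ : Config N → ℂ` of class
  `C¹` on the ambient space, vanishing off the open box `Λ_L^N`, permutation-symmetric (Bose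
  statistics) and `L²`-normalised. This class contains `C_c^∞(Λ_L^N)_sym`, a form core of the
  Dirichlet realisation of `H_N`, so infima over it are spectral infima.
* `energy v Ψ = ∫ (|∇Ψ|² + ∑_{i<j} v(|xᵢ-xⱼ|) |Ψ|²)` as an `ℝ≥0∞`-valued lower Lebesgue integral;
  the potential is a radial profile `v : ℝ → ℝ≥0∞` (value `⊤` allowed: hard spheres of diameter
  `a` are `v = ⊤ · 1_{[0,a]}`, with `⊤ · 0 = 0` where `Ψ` vanishes).
* `groundStateEnergy v N L = inf_Ψ energy v Ψ = E₀(N, L)`.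
* `occupation N φ Ψ = ⟨φ, γ_Ψ φ⟩ = N ∫ |∫ conj(φ(x)) Ψ(x, X) dx|² dX` — the expected occupation of
  the one-particle mode `φ` in `Ψ`, where `γ_Ψ(x,x') = N ∫ Ψ(x,X) conj(Ψ(x',X)) dX` is the
  one-particle density matrix [LSSY (1.17)]; `maxOccupation N Ψ = sup_{‖φ‖=1} ⟨φ, γ_Ψ φ⟩`, which
  for the positive trace-class operator `γ_Ψ` is its largest eigenvalue `‖γ_Ψ‖`.
* `condensateNumber v N L = sup_{δ>0} inf {maxOccupation Ψ | energy Ψ ≤ E₀ + δ}` — the largest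
  eigenvalue of the one-particle density matrix **of the ground state**, defined through
  energy-minimising sequences so that no eigenfunction has to be exhibited: for fixed `N, L` the
  Dirichlet `H_N` has compact resolvent, minimising sequences converge (up to phase) to the ground
  state `Ψ₀` when it is unique (it is, for `v` finite a.e.: positivity improving semigroup,
  Reed–Simon IV, XIII.12), `Ψ ↦ γ_Ψ` is `L² →` trace-norm continuous, hence
  `condensateNumber = λ_max(γ_{Ψ₀})`; for a degenerate ground space it is the infimum of
  `λ_max` over (limits of) ground states — the honest "every ground state condenses" reading.
* `sideLength ρ N = (N/ρ)^{1/3}`; `HasGroundStateBEC v ρ` — LSSY's definition of BEC in the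
  ground state at density `ρ`: `∃ c > 0`, for all large `N`, `λ_max(γ_{Ψ₀}) ≥ c N` with
  `L = (N/ρ)^{1/3}` [LSSY (1.19), (5.2) and the sentence following (1.19)].
* `IsRepulsiveFiniteRange v` — the standing class of interactions of LSSY Ch. 2: `v ≥ 0`
  (automatic in `ℝ≥0∞`), measurable, of finite range `R₀`.
* `BoseEinsteinCondensation` — the named **conjecture** (open since Bogoliubov 1947 /
  Penrose–Onsager 1956; "the problem remains open", LSSY Ch. 5, p. 42): for every repulsive
  finite-range radial pair potential, the ground state of the *dilute* three-dimensional Bose gas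
  exhibits BEC in the thermodynamic limit, i.e. `HasGroundStateBEC v ρ` for all sufficiently
  small densities `ρ > 0`.

## Design choices

* **Quantifiers of the conjecture.** LSSY define BEC at a fixed density and call its proof for
  genuinely interacting systems open, without fixing the range of `(v, ρ)`. We state the *dilute*
  form (`∀ v, ∃ ρ₀ > 0, ∀ ρ ∈ (0, ρ₀)`), which is what Bogoliubov theory predicts uncontroversially
  and is implied by the fixed-density form for every `ρ`; at high density some repulsive
  potentials are expected to crystallise (quantum solid), where ground-state BEC is not the
  accepted expectation, so `∀ ρ > 0` would overstate the conjecture. The parametric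
  `HasGroundStateBEC v ρ` is exposed for other variants (positive temperature is a Literature
  variant, per D-0013 ruling "ground state / low T: state the `T = 0` form").
* **Boundary conditions.** Dirichlet (trial functions vanish off the open box). BEC in the
  thermodynamic limit, like the ground-state energy density [LSSY Ch. 2, after Thm 2.1/(2.8): "independent
  of the boundary conditions"], is expected to be insensitive to this choice; LSSY (1.16)–(1.19) do not fix
  boundary conditions, Ch. 5 uses periodic/Neumann for the GP-limit theorem.
* **No operators.** Everything is variational: energies are `∫⁻` of nonnegative densities over
  `C¹` trial states, `λ_max(γ)` is `sup_φ ⟨φ, γ φ⟩`, and the ground state enters only through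
  near-minimisers (`condensateNumber`). This avoids self-adjoint extensions, partial traces and
  `H¹₀`, none of which the statement needs; the price is the (documented) identification above.
* `ℝ≥0∞` throughout: no junk values from `sInf ∅`/`sSup` on `ℝ`; `TrialState N L` is empty for
  `N = 0` or `L ≤ 0` (then `E₀ = ⊤`, `condensateNumber = ⊤`), irrelevant under `∀ᶠ N in atTop`.
* Mathlib has no many-body Schrödinger operators, density matrices or BEC (searched
  `Bose`, `densityMatrix`, `GrossPitaevskii`, `Schrodinger` many-body); `EuclideanSpace`,
  `fderiv`, `lintegral`, Bochner `integral`, `Equiv.Perm` are Mathlib's.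

## References

* [LSSY2005] E. H. Lieb, R. Seiringer, J. P. Solovej, J. Yngvason, *The Mathematics of the Bose
  Gas and its Condensation*, Oberwolfach Seminars 34, Birkhäuser 2005 (arXiv:cond-mat/0610117):
  §1.2 (1.16)–(1.19) (definition of BEC via the one-particle density matrix), Ch. 5 (5.1)–(5.2)
  and p. 42 ("The problem remains open after more than 75 years").
* O. Penrose, L. Onsager, *Bose–Einstein condensation and liquid helium*, Phys. Rev. 104 (1956)
  576 — the density-matrix criterion.
* E. H. Lieb, R. Seiringer, *Proof of Bose–Einstein condensation for dilute trapped gases*,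
  Phys. Rev. Lett. 88 (2002) 170409 — BEC in the Gross–Pitaevskii limit (not the thermodynamic
  limit).
* M. Reed, B. Simon, *Methods of Modern Mathematical Physics IV*, XIII.12 and XIII.47
  (uniqueness/positivity of ground states), XIII.64 (compact resolvent).
-/

noncomputable section

open MeasureTheory Filter Metric
open scoped ENNReal NNReal ComplexConjugate

namespace Literature.MathematicalPhysics.QuantumManyBody.BoseGas

/-- One-particle configuration space `ℝ³` (Euclidean, with Lebesgue measure). [folklore] -/
abbrev Space : Type := EuclideanSpace ℝ (Fin 3)

/-- `N`-particle configuration space `(ℝ³)^N`, points written `X = (x₁, …, x_N)`, `X i = xᵢ`;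
product Lebesgue measure. [cite: LSSY2005, §1.2 (1.16)–(1.18)] -/
abbrev Config (N : ℕ) : Type := Fin N → Space

/-- The open box `Λ_L = (0, L)³ ⊂ ℝ³` of side `L`. [cite: LSSY2005, §1.2] -/
def box (L : ℝ) : Set Space :=
  {x | ∀ k, x k ∈ Set.Ioo 0 L}

/-- The `N`-particle box `Λ_L^N ⊂ (ℝ³)^N`. [cite: LSSY2005, §1.2] -/
def boxN (N : ℕ) (L : ℝ) : Set (Config N) :=
  {X | ∀ i, X i ∈ box L}

/-- The side length `L = (N/ρ)^{1/3}` of the box holding `N` particles at density `ρ = N/L³`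
(thermodynamic limit at fixed density). [cite: LSSY2005, §1.2 (after (1.19))] -/
def sideLength (ρ : ℝ) (N : ℕ) : ℝ :=
  ((N : ℝ) / ρ) ^ (1 / 3 : ℝ)

/-- Admissible (bosonic, Dirichlet) trial wave functions for `N` particles in the box `Λ_L`:
`ψ : (ℝ³)^N → ℂ` continuously differentiable on the ambient space, vanishing off the open box
`Λ_L^N` (Dirichlet condition), symmetric under permutations of the particles (Bose statistics),
and normalised in `L²`. This class contains the symmetric `C_c^∞(Λ_L^N)` functions, a form core
of the Dirichlet Hamiltonian, and is contained in its form domain. Empty if `N = 0` or `L ≤ 0`.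
[cite: LSSY2005, §1.2 (1.16)–(1.17)] -/
structure TrialState (N : ℕ) (L : ℝ) where
  /-- The wave function `Ψ(x₁, …, x_N)`. -/
  ψ : Config N → ℂ
  /-- `Ψ` is `C¹` on `(ℝ³)^N`. -/
  contDiff : ContDiff ℝ 1 ψ
  /-- Dirichlet condition: `Ψ` vanishes off the open box `Λ_L^N`. -/
  eq_zero : ∀ X, X ∉ boxN N L → ψ X = 0
  /-- Bose symmetry: `Ψ(x_{σ 1}, …, x_{σ N}) = Ψ(x₁, …, x_N)`. -/
  symm : ∀ (σ : Equiv.Perm (Fin N)) (X : Config N), ψ (X ∘ σ) = ψ X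
  /-- Normalisation `∫ |Ψ|² = 1`. -/
  norm_eq : ∫⁻ X, (‖ψ X‖₊ : ℝ≥0∞) ^ 2 = 1

/-- The kinetic energy density `|∇Ψ(X)|² = ∑ᵢ ∑ₖ |∂Ψ/∂x_{i,k}(X)|²` (sum over particles `i` and
coordinates `k = 1,2,3` of the squared partial derivatives; units `ħ = 2m = 1`).
[cite: LSSY2005, §1.2 (1.16)] -/
def kineticDensity {N : ℕ} (ψ : Config N → ℂ) (X : Config N) : ℝ≥0∞ :=
  ∑ i : Fin N, ∑ k : Fin 3,
    (‖fderiv ℝ ψ X (Pi.single i (EuclideanSpace.single k (1 : ℝ)))‖₊ : ℝ≥0∞) ^ 2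

/-- The interaction `∑_{i<j} v(|xᵢ - xⱼ|)` of the configuration `X` for a radial pair-potential
profile `v : ℝ → ℝ≥0∞` (`⊤` allowed, e.g. hard cores). [cite: LSSY2005, §1.2 (1.16)] -/
def interaction {N : ℕ} (v : ℝ → ℝ≥0∞) (X : Config N) : ℝ≥0∞ :=
  ∑ i : Fin N, ∑ j : Fin N with i < j, v (dist (X i) (X j))

/-- The energy `⟨Ψ, H_N Ψ⟩ = ∫ (|∇Ψ|² + ∑_{i<j} v(|xᵢ-xⱼ|) |Ψ|²) dX ∈ [0, ∞]` of a trial state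
(quadratic form of `H_N = -∑Δᵢ + ∑_{i<j} v(|xᵢ-xⱼ|)`, `ħ = 2m = 1`). [cite: LSSY2005, §1.2 (1.16)] -/
def energy {N : ℕ} {L : ℝ} (v : ℝ → ℝ≥0∞) (Ψ : TrialState N L) : ℝ≥0∞ :=
  ∫⁻ X, kineticDensity Ψ.ψ X + interaction v X * (‖Ψ.ψ X‖₊ : ℝ≥0∞) ^ 2

/-- The ground-state energy `E₀(N, L) = inf_Ψ ⟨Ψ, H_N Ψ⟩` of `N` bosons in the box `Λ_L`
(Dirichlet), as the infimum of `energy` over admissible trial states (`⊤` if there are none,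
i.e. `N = 0` or `L ≤ 0`, or if no trial state has finite energy). [cite: LSSY2005, §1.2 and (2.3)] -/
def groundStateEnergy (v : ℝ → ℝ≥0∞) (N : ℕ) (L : ℝ) : ℝ≥0∞ :=
  ⨅ Ψ : TrialState N L, energy v Ψ

/-- The expected occupation `⟨φ, γ_Ψ φ⟩ = N ∫ |∫ conj(φ(x)) Ψ(x, X) dx|² dX` of the one-particle
mode `φ : ℝ³ → ℂ` in the `N`-particle wave function `Ψ`, where
`γ_Ψ(x, x') = N ∫ Ψ(x, X) conj(Ψ(x', X)) dX` is the one-particle density matrix and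
`X = (x₂, …, x_N)`; `0` for `N = 0`. [cite: LSSY2005, §1.2 (1.17)] -/
def occupation : (N : ℕ) → (Space → ℂ) → (Config N → ℂ) → ℝ≥0∞
  | 0, _, _ => 0
  | n + 1, φ, Ψ => (n + 1 : ℝ≥0∞) *
      ∫⁻ Y : Config n, (‖∫ x, conj (φ x) * Ψ (Matrix.vecCons x Y)‖₊ : ℝ≥0∞) ^ 2

/-- The largest eigenvalue `λ_max(γ_Ψ) = ‖γ_Ψ‖ = sup_{‖φ‖₂ = 1} ⟨φ, γ_Ψ φ⟩` of the (positive,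
trace-class) one-particle density matrix of `Ψ`, as a supremum of occupations over normalised
measurable modes. [cite: LSSY2005, §1.2 (after (1.18))] -/
def maxOccupation (N : ℕ) (Ψ : Config N → ℂ) : ℝ≥0∞ :=
  ⨆ (φ : Space → ℂ) (_ : AEStronglyMeasurable φ volume ∧ ∫⁻ x, (‖φ x‖₊ : ℝ≥0∞) ^ 2 = 1),
    occupation N φ Ψ

/-- The condensate occupation `λ_max(γ_{Ψ₀})` **of the ground state** `Ψ₀` of `N` bosons in
`Λ_L`, defined through minimising sequences: `sup_{δ > 0} inf {λ_max(γ_Ψ) | ⟨Ψ, H_N Ψ⟩ ≤ E₀ + δ}`.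
For fixed `N, L` (compact resolvent, spectral gap) near-minimisers converge to the ground state
and `Ψ ↦ γ_Ψ` is trace-norm continuous, so this is `λ_max` of the one-particle density matrix of
the (unique) ground state; for a degenerate ground space it is the infimum over ground states.
[cite: LSSY2005, §1.2 (1.17)–(1.19)] -/
def condensateNumber (v : ℝ → ℝ≥0∞) (N : ℕ) (L : ℝ) : ℝ≥0∞ :=
  ⨆ (δ : ℝ≥0∞) (_ : 0 < δ),
    ⨅ (Ψ : TrialState N L) (_ : energy v Ψ ≤ groundStateEnergy v N L + δ), maxOccupation N Ψ.ψ

/-- **BEC in the ground state at density `ρ`** (Penrose–Onsager; LSSY): there is `c > 0` such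
that for all large `N`, with `L = (N/ρ)^{1/3}`, the one-particle density matrix of the ground
state of `H_N` on `Λ_L` has largest eigenvalue `≥ c N`. [cite: LSSY2005, §1.2 (1.19) and Ch. 5 (5.1)–(5.2)] -/
def HasGroundStateBEC (v : ℝ → ℝ≥0∞) (ρ : ℝ) : Prop :=
  ∃ c : ℝ, 0 < c ∧ ∀ᶠ N : ℕ in atTop,
    ENNReal.ofReal (c * N) ≤ condensateNumber v N (sideLength ρ N)

/-- The standing class of pair interactions: a radial profile `v : ℝ → [0, ∞]` (repulsive: `v ≥ 0`
is automatic; hard cores `v = ⊤` allowed) that is measurable and of finite range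
(`v(r) = 0` for `r > R₀`). [cite: LSSY2005, Ch. 2 (2.1) and §1.2 (1.16)] -/
def IsRepulsiveFiniteRange (v : ℝ → ℝ≥0∞) : Prop :=
  Measurable v ∧ ∃ R₀ : ℝ, ∀ r, R₀ < r → v r = 0

/-- **Bose–Einstein condensation for the dilute interacting Bose gas (conjecture; open).**
For every repulsive, finite-range, radial pair potential `v`, the ground state of the
three-dimensional continuum Bose gas `H_N = -∑Δᵢ + ∑_{i<j} v(|xᵢ-xⱼ|)` exhibits Bose–Einstein
condensation in the thermodynamic limit at every sufficiently small density: there is `ρ₀ > 0`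
such that for all `0 < ρ < ρ₀` the largest eigenvalue of the one-particle density matrix of the
ground state in the box of side `(N/ρ)^{1/3}` is `≥ c(ρ) N` for all large `N`
(`HasGroundStateBEC v ρ`). LSSY: BEC "has, so far, never been proved for many-body Hamiltonians
with genuine interactions" (§1.2); "The problem remains open after more than 75 years" (Ch. 5).
Conjunct of the summit `AtomisticToContinuum`. [cite: LSSY2005, §1.2 and Ch. 5 p. 42] -/
def BoseEinsteinCondensation : Prop :=
  ∀ v : ℝ → ℝ≥0∞, IsRepulsiveFiniteRange v →
    ∃ ρ₀ : ℝ, 0 < ρ₀ ∧ ∀ ρ : ℝ, 0 < ρ → ρ < ρ₀ → HasGroundStateBEC v ρ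

/-! ### Basic API -/

/-- The ground-state energy is a lower bound for the energy of every trial state (variational
principle, by definition of the infimum). [cite: LSSY2005, (2.3)] -/
theorem groundStateEnergy_le_energy {N : ℕ} {L : ℝ} (v : ℝ → ℝ≥0∞) (Ψ : TrialState N L) :
    groundStateEnergy v N L ≤ energy v Ψ :=
  iInf_le _ Ψ

/-- The occupation of any normalised measurable mode bounds `λ_max(γ_Ψ)` from below
(by definition of the supremum). [cite: LSSY2005, §1.2] -/
theorem occupation_le_maxOccupation {N : ℕ} (Ψ : Config N → ℂ) {φ : Space → ℂ}
    (hφ : AEStronglyMeasurable φ volume) (hφ₁ : ∫⁻ x, (‖φ x‖₊ : ℝ≥0∞) ^ 2 = 1) :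
    occupation N φ Ψ ≤ maxOccupation N Ψ :=
  le_iSup₂ (f := fun φ _ => occupation N φ Ψ) φ ⟨hφ, hφ₁⟩

/-- Every near-minimiser controls the condensate number from above at its own energy slack:
if `energy Ψ ≤ E₀ + δ` then the `δ`-level infimum is `≤ λ_max(γ_Ψ)`. [cite: LSSY2005, §1.2] -/
theorem iInf_maxOccupation_le {N : ℕ} {L : ℝ} (v : ℝ → ℝ≥0∞) {δ : ℝ≥0∞} (Ψ : TrialState N L)
    (h : energy v Ψ ≤ groundStateEnergy v N L + δ) :
    ⨅ (Φ : TrialState N L) (_ : energy v Φ ≤ groundStateEnergy v N L + δ), maxOccupation N Φ.ψ ≤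
      maxOccupation N Ψ.ψ :=
  iInf₂_le Ψ h

/-- A uniform lower bound on `λ_max` over all `δ`-near-minimisers, for some `δ > 0`, bounds the
condensate number from below (how BEC is to be *proved*: exhibit `δ` and the bound).
[cite: LSSY2005, §1.2 (1.19)] -/
theorem le_condensateNumber {N : ℕ} {L : ℝ} (v : ℝ → ℝ≥0∞) {δ m : ℝ≥0∞} (hδ : 0 < δ)
    (h : ∀ Ψ : TrialState N L, energy v Ψ ≤ groundStateEnergy v N L + δ →
      m ≤ maxOccupation N Ψ.ψ) :
    m ≤ condensateNumber v N L :=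
  le_iSup₂_of_le (f := fun δ _ => ⨅ (Ψ : TrialState N L)
      (_ : energy v Ψ ≤ groundStateEnergy v N L + δ), maxOccupation N Ψ.ψ) δ hδ
    (le_iInf₂ h)

/-- The interaction of a finite-range potential vanishes on configurations whose particles are
pairwise farther apart than the range. [cite: LSSY2005, Ch. 2 (2.1)] -/
theorem interaction_eq_zero_of_lt_dist {N : ℕ} {v : ℝ → ℝ≥0∞} {R₀ : ℝ}
    (hv : ∀ r, R₀ < r → v r = 0) {X : Config N} (hX : ∀ i j, i < j → R₀ < dist (X i) (X j)) :
    interaction v X = 0 := by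
  refine Finset.sum_eq_zero fun i _ => Finset.sum_eq_zero fun j hj => ?_
  exact hv _ (hX i j (Finset.mem_filter.1 hj).2)

/-- With `L = (N/ρ)^{1/3}` the density is exactly `ρ`: `N / L³ = ρ` (for `ρ > 0`, `N > 0`).
[cite: LSSY2005, §1.2] -/
theorem div_sideLength_pow_three {ρ : ℝ} (hρ : 0 < ρ) {N : ℕ} (hN : 0 < N) :
    (N : ℝ) / sideLength ρ N ^ 3 = ρ := by
  have h : (0 : ℝ) ≤ N / ρ := div_nonneg N.cast_nonneg hρ.le
  rw [sideLength, ← Real.rpow_natCast, ← Real.rpow_mul h]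
  norm_num
  field_simp

/-- **Non-vacuity.** For every `L > 0` the class of admissible trial states is inhabited
(already for one particle): a normalised smooth bump function centred in the box. Hence
`groundStateEnergy`/`condensateNumber` are not infima over an empty type for `N = 1`; the
`N`-particle analogue is the symmetrised product of one-particle bumps. [folklore] -/
theorem TrialState.nonempty_one {L : ℝ} (hL : 0 < L) : Nonempty (TrialState 1 L) := by
  let c : Config 1 := fun _ => WithLp.toLp 2 (fun _ : Fin 3 => L / 2)
  let f : ContDiffBump c := ⟨L / 8, L / 4, by positivity, by linarith⟩
  set A : ℝ≥0∞ := ∫⁻ X, (‖f X‖₊ : ℝ≥0∞) ^ 2 with hA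
  have hmeas : Measurable (fun X => (‖f X‖₊ : ℝ≥0∞) ^ 2) :=
    (f.continuous.measurable.nnnorm.coe_nnreal_ennreal).pow_const 2
  -- finiteness
  have hAtop : A ≠ ⊤ := by
    have hint : Integrable (fun X => f X ^ 2) volume :=
      (f.continuous.pow 2).integrable_of_hasCompactSupport
        (f.hasCompactSupport.mul_left (f' := f))
    have := hint.2
    rw [HasFiniteIntegral] at this
    refine ne_top_of_le_ne_top this.ne (le_of_eq ?_)
    refine lintegral_congr fun X => ?_
    rw [enorm_pow]
    rfl
  -- positivity
  have hA0 : A ≠ 0 := by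
    have h1 : volume (closedBall c f.rIn) ≤ A := by
      calc volume (closedBall c f.rIn) = ∫⁻ X in closedBall c f.rIn, 1 := (setLIntegral_one _).symm
        _ = ∫⁻ X in closedBall c f.rIn, (‖f X‖₊ : ℝ≥0∞) ^ 2 := by
            refine setLIntegral_congr_fun measurableSet_closedBall (fun X hX => ?_)
            rw [f.one_of_mem_closedBall hX]; simp
        _ ≤ A := setLIntegral_le_lintegral _ _
    have h2 : 0 < volume (closedBall c f.rIn) := measure_closedBall_pos volume c (by
      show 0 < L / 8; positivity)
    exact (h2.trans_le h1).ne'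
  let k : ℝ≥0 := NNReal.sqrt (A.toNNReal)⁻¹
  have hk : (k : ℝ≥0∞) ^ 2 * A = 1 := by
    rw [← ENNReal.coe_pow, NNReal.sq_sqrt, ENNReal.coe_inv (ENNReal.toNNReal_ne_zero.2 ⟨hA0, hAtop⟩),
      ENNReal.coe_toNNReal hAtop, ENNReal.inv_mul_cancel hA0 hAtop]
  refine ⟨⟨fun X => (k : ℂ) * (f X : ℂ), ?_, ?_, ?_, ?_⟩⟩
  · exact contDiff_const.mul (Complex.ofRealCLM.contDiff.comp f.contDiff)
  · intro X hX
    suffices f X = 0 by simp [this]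
    rw [← Function.notMem_support, f.support_eq]
    intro hball
    apply hX
    intro i j
    have h1 : dist (X i) (c i) < L / 4 := (dist_le_pi_dist X c i).trans_lt hball
    have h2 : dist (X i j) (L / 2) < L / 4 := (PiLp.dist_apply_le (X i) (c i) j).trans_lt h1
    rw [Real.dist_eq, abs_lt] at h2
    constructor <;> linarith [h2.1, h2.2]
  · intro σ X
    rw [Subsingleton.elim σ 1, Equiv.Perm.coe_one, Function.comp_id]
  · have : ∀ X, (‖(k : ℂ) * (f X : ℂ)‖₊ : ℝ≥0∞) ^ 2 = (k : ℝ≥0∞) ^ 2 * (‖f X‖₊ : ℝ≥0∞) ^ 2 := by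
      intro X
      rw [nnnorm_mul, ENNReal.coe_mul, mul_pow]
      congr 2
      · simp
      · rw [Complex.nnnorm_real]
    simp_rw [this]
    rw [lintegral_const_mul _ hmeas, hk]

end Literature.MathematicalPhysics.QuantumManyBody.BoseGas

end
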